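import Literature.NumberTheory.EllipticCurves.HeegnerHypothesisKroneckerProofs
import Literature.NumberTheory.EllipticCurves.HeegnerPointsImaginaryQuadraticProofs
import Literature.NumberTheory.QuadraticFields.QuadraticDedekindZeta
import Literature.NumberTheory.EllipticCurves.SerreOpenImageOrdinaryInertiaProofs
import Literature.NumberTheory.EllipticCurves.ModularityVersionApProofs
import Literature.NumberTheory.EllipticCurves.GlobalMinimalModel
import HarnessLib

/-!
# Route `GenusKolyvaginAtTwo`, crux `GenusPrimitiveSupplyAtTwo` (stmt-BirchSwinnertonDyer-22136):
# Heegner-twin parity — `(Δ_E | |d_K|) = sign Δ_E`, and the transposition primes of `d_K`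

Seat `bsd-line-gk2-p5` g2 (cell `bsd-f1-sign2`), SUPPLY lineage (g0: `…TwinSupply.lean`, `…TwinSupplyPrint.lean`).
Summit-side THEOREM-ONLY file (no definition, no named fact, no `sorry`), `--supports stmt-BirchSwinnertonDyer-22136`.

WHY. The route's supply clause produces, for a habitat curve `E` (globally minimal `W`), a Heegner field `K` with ODD
discriminant `d_K` (Kolyvagin's (H2) frame) and the twin `E^{(d_K)}`. At a prime `q ∣ d_K` the twin has Kodaira type `I₀*`
with Tamagawa number `c_q = 1 + #{roots of the 2-division cubic of E mod q}` (Tate's algorithm, Step 6), and the root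
count `r_q ∈ {0, 1, 3}` is governed by the Legendre symbol `(Δ_E / q)`: `r_q = 1` («transposition prime», Frobenius an
odd permutation of `E[2] ∖ 0`) iff `(Δ_E / q) = −1`. THIS FILE proves the global constraint tying these local types to
the SIGN of the minimal discriminant:

* `jacobiSym_eq_sign` — pure reciprocity: `m ≡ 3 (mod 4)`, every odd prime `p ∣ Δ` has `(−m / p) = 1`, and
  `2 ∣ Δ ⇒ m ≡ 7 (mod 8)`; then the Jacobi symbol `(Δ | m) = sign Δ`.
* `jacobiSym_minimalDiscriminantInt_natAbs_discr` — for `W/ℚ` globally minimal, `K` imaginary quadratic with odd `d_K`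
  satisfying the Heegner hypothesis for the conductor of `W`: **`(Δ_min(W) | |d_K|) = sign Δ_min(W)`** (every prime of
  `Δ_min` divides the conductor, hence splits in `K`; quadratic reciprocity for the Jacobi symbol).
* `exists_prime_dvd_discr_jacobiSym_eq_neg_one_of_Δ_neg` — **`Δ_W < 0` ⇒ some prime `q ∣ d_K` has `(Δ_min / q) = −1`**
  (a transposition prime; `q` odd, `q ∤ N`), i.e. the number of transposition primes of `d_K` is ODD for `Δ_W < 0` and
  EVEN for `Δ_W > 0` (`jacobiSym_minimalDiscriminantInt_natAbs_discr_of_Δ_pos`). This is the kernel-checked form of the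
  parity constraint «DEF(E,K) = Σ_{q∣d_K} dim Ẽ(𝔽_q)[2] + [Δ_E > 0] is odd» used on the cell bus (gk2-p2 g4, note #4), and
  the input of the companion file `…HeegnerTwinTamagawa.lean`: for `Δ_W < 0` EVERY odd-`d_K` Heegner twin has an EVEN
  Tamagawa product, so the odd-Tamagawa bridge `MinimalTwinBSDTwo ⟸ RankOneAtTwoBigImageOddLocal` (gk2-p4,
  `Theorems/GenusKolyvaginAtTwoMinimalTwinBSDTwoBridges.lean`) is vacuous on the `Δ < 0` habitat.
* `exists_isRoot_of_not_isSquare_discr` — finite-field lemma (odd characteristic): a cubic whose discriminant is a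
  NON-square has a root (Frobenius is then an odd permutation of the three roots, hence a transposition); with
  `eval_derivative_ne_zero_of_discr_ne_zero` (a root of a cubic with non-zero discriminant is simple).

References: [SilvermanAEC2009] III.1 (b₂, b₄, b₆, `ψ₂² = 4x³ + b₂x² + 2b₄x + b₆`, `disc = 16Δ`), VIII.8 (minimal
discriminant); [IrelandRosen1990] Prop. 5.2.2 (Jacobi reciprocity); [Cox2013] Lemma 1.14, Thm. 2.? (`χ_{d_K}`);
[SilvermanATAEC1994] IV.9.4 Step 6 (`c = 1 + #roots`). No item is closed by this file; BSD is not proved by any of this.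
-/

set_option linter.dupNamespace false -- tree convention: `Summit.BirchSwinnertonDyer.BirchSwinnertonDyer.Theorems` (summit = sub-problem)
set_option autoImplicit false

open NumberField

namespace Summit.BirchSwinnertonDyer.BirchSwinnertonDyer.Theorems.GenusKolyTwin

/-! ## §1. Reciprocity: `(Δ | m) = sign Δ` -/

/-- If every prime factor `p` of `a ≠ 0` has `J(x | p) = 1` then `J(x | a) = 1` (the Jacobi symbol is the product of
the Legendre symbols at the prime factors). [folklore] -/
theorem jacobiSym_eq_one_of_forall_prime {x : ℤ} {a : ℕ} (ha : a ≠ 0)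
    (h : ∀ p : ℕ, p.Prime → p ∣ a → jacobiSym x p = 1) : jacobiSym x a = 1 := by
  have hf₀ : ∀ p ∈ a.primeFactorsList, p ≠ 0 := fun p hp => (Nat.pos_of_mem_primeFactorsList hp).ne'
  conv_lhs => rw [← Nat.prod_primeFactorsList ha]
  rw [jacobiSym.list_prod_right hf₀]
  refine List.prod_eq_one fun y hy => ?_
  obtain ⟨p, hp, rfl⟩ := List.mem_map.mp hy
  exact h p (Nat.prime_of_mem_primeFactorsList hp) (Nat.dvd_of_mem_primeFactorsList hp)

/-- **Reciprocity core.** Let `m ≡ 3 (mod 4)` and `Δ ≠ 0` be such that every odd prime `p ∣ Δ` satisfies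
`J(−m | p) = 1` and `2 ∣ Δ ⇒ m ≡ 7 (mod 8)`. Then `J(Δ | m) = sign Δ`. (Write `|Δ| = 2^e·a` with `a` odd:
`J(−m | a) = 1` prime by prime, so `J(m | a) = χ₄(a)`; quadratic reciprocity with `m ≡ 3 (4)` gives `J(a | m) =
χ₄(a)·J(m | a) = 1`; `J(2 | m) = χ₈(m) = 1` when `e > 0`; and `J(−1 | m) = χ₄(m) = −1`.)
[cite: IrelandRosen1990, Prop. 5.2.2] -/
theorem jacobiSym_eq_sign {m : ℕ} (hm4 : m % 4 = 3) {Δ : ℤ} (hΔ : Δ ≠ 0)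
    (h1 : ∀ p : ℕ, p.Prime → p ≠ 2 → (p : ℤ) ∣ Δ → jacobiSym (-(m : ℤ)) p = 1)
    (h2 : (2 : ℤ) ∣ Δ → m % 8 = 7) :
    jacobiSym Δ m = Δ.sign := by
  have hmodd : Odd m := Nat.odd_iff.mpr (by omega)
  obtain ⟨e, a, ha, hea⟩ := Nat.exists_eq_two_pow_mul_odd (Int.natAbs_ne_zero.mpr hΔ)
  have ha0 : a ≠ 0 := by
    rintro rfl
    exact (Nat.not_odd_zero ha).elim
  have hΔeq : Δ = Δ.sign * ((2 : ℤ) ^ e * (a : ℤ)) := by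
    conv_lhs => rw [← Int.sign_mul_natAbs Δ, hea]
    push_cast
    ring
  -- `J(a | m) = 1`
  have hJa : jacobiSym (a : ℤ) m = 1 := by
    have hma : jacobiSym (-(m : ℤ)) a = 1 := by
      refine jacobiSym_eq_one_of_forall_prime ha0 fun p hp hpa => ?_
      have hp2 : p ≠ 2 := by
        rintro rfl
        exact (Nat.not_even_iff_odd.mpr ha) (even_iff_two_dvd.mpr hpa)
      refine h1 p hp hp2 (Int.ofNat_dvd_left.mpr ?_)
      rw [hea]
      exact Dvd.dvd.mul_left hpa _
    rw [jacobiSym.neg _ ha] at hma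
    rcases Nat.odd_mod_four_iff.mp (Nat.odd_iff.mp ha) with ha1 | ha3
    · rw [jacobiSym.quadratic_reciprocity_one_mod_four ha1 hmodd]
      rwa [ZMod.χ₄_nat_one_mod_four ha1, one_mul] at hma
    · rw [jacobiSym.quadratic_reciprocity_three_mod_four ha3 hm4]
      rw [ZMod.χ₄_nat_three_mod_four ha3, neg_mul, one_mul, neg_eq_iff_eq_neg] at hma
      rw [hma, neg_neg]
  -- `J(2 | m) ^ e = 1`
  have hJ2 : jacobiSym 2 m ^ e = 1 := by
    rcases Nat.eq_zero_or_pos e with he | he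
    · rw [he, pow_zero]
    · have h2Δ : (2 : ℤ) ∣ Δ := by
        refine Int.ofNat_dvd_left.mpr ?_
        rw [hea]
        exact Dvd.dvd.mul_right (dvd_pow_self 2 he.ne') a
      have hm8 := h2 h2Δ
      rw [jacobiSym.at_two hmodd, ZMod.χ₈_nat_eq_if_mod_eight, if_neg (by omega), if_pos (Or.inr hm8), one_pow]
  -- `J(sign Δ | m) = sign Δ`
  have hJs : jacobiSym Δ.sign m = Δ.sign := by
    rcases lt_or_gt_of_ne hΔ with hneg | hpos
    · rw [Int.sign_eq_neg_one_of_neg hneg, jacobiSym.at_neg_one hmodd, ZMod.χ₄_nat_three_mod_four hm4]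
    · rw [Int.sign_eq_one_of_pos hpos, jacobiSym.one_left]
  conv_lhs => rw [hΔeq]
  rw [jacobiSym.mul_left, jacobiSym.mul_left, jacobiSym.pow_left, hJs, hJ2, hJa, mul_one, mul_one]

/-! ## §2. The elliptic-curve form: `(Δ_min | |d_K|) = sign Δ_min` under the Heegner hypothesis -/

open WeierstrassCurve Literature.NumberTheory.EllipticCurves

variable (W : WeierstrassCurve ℚ) [W.IsElliptic] [W.IsGloballyMinimal]
  {K : Type} [Field K] [NumberField K]

/-- A prime dividing the minimal discriminant divides the conductor (bad reduction; Silverman *AEC* VII.5 Prop. 5.1(a),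
VIII.8). [cite: SilvermanAEC2009, VII.5 Prop. 5.1 and VIII.8] -/
theorem dvd_conductorNorm_of_dvd_minimalDiscriminantInt {p : ℕ} (hp : p.Prime)
    (hpΔ : (p : ℤ) ∣ minimalDiscriminantInt W) : p ∣ W.conductorNorm ℤ := by
  haveI := Fact.mk hp
  exact (W.dvd_conductorNorm_iff_not_hasGoodReductionAtPrime p).mpr
    fun hgood => W.not_dvd_minimalDiscriminantInt_of_hasGoodReductionAtPrime' p hgood hpΔ

/-- **`(Δ_min(W) | |d_K|) = sign Δ_min(W)`** for `W/ℚ` globally minimal and `K` imaginary quadratic with odd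
discriminant satisfying the Heegner hypothesis for the conductor of `W`: every prime of `Δ_min` divides the conductor
and therefore splits in `K` (`(d_K / p) = 1` for odd `p`, `d_K ≡ 1 (mod 8)` at `p = 2`), `d_K = −m` with `m ≡ 3 (mod 4)`,
and `jacobiSym_eq_sign` applies. [cite: SilvermanAEC2009, VIII.8] [cite: IrelandRosen1990, Prop. 5.2.2] -/
theorem jacobiSym_minimalDiscriminantInt_natAbs_discr (hK : IsImaginaryQuadratic K) (hodd : Odd (discr K))
    (hH : SatisfiesHeegnerHypothesis (W.conductorNorm ℤ) K) :
    jacobiSym (minimalDiscriminantInt W) (discr K).natAbs = (minimalDiscriminantInt W).sign := by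
  have hneg : discr K < 0 := IsImaginaryQuadratic.discr_neg hK
  have h4 : discr K % 4 = 1 := Literature.NumberTheory.QuadraticFields.Quadratic.discr_emod_four_eq_one hK.1 hodd
  have hDm : discr K = -((discr K).natAbs : ℤ) := by omega
  have hm4 : (discr K).natAbs % 4 = 3 := by omega
  refine jacobiSym_eq_sign hm4 (minimalDiscriminantInt_ne_zero W) (fun p hp hp2 hpΔ => ?_) (fun h2Δ => ?_)
  · rw [← hDm]
    exact Literature.SatisfiesHeegnerHypothesis.jacobiSym_discr_eq_one hK.1 hH hp
      (dvd_conductorNorm_of_dvd_minimalDiscriminantInt W hp hpΔ) hp2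
  · have h8 := Literature.SatisfiesHeegnerHypothesis.discr_emod_eight hK.1 hH
      (dvd_conductorNorm_of_dvd_minimalDiscriminantInt W Nat.prime_two (by exact_mod_cast h2Δ))
    omega

omit [W.IsElliptic] in
/-- The sign of the minimal discriminant is the sign of `W.Δ` (they are the same number). [folklore] -/
theorem sign_minimalDiscriminantInt_eq_neg_one_iff : (minimalDiscriminantInt W).sign = -1 ↔ W.Δ < 0 := by
  rw [Int.sign_eq_neg_one_iff_neg, ← cast_minimalDiscriminantInt W]
  exact Int.cast_lt_zero.symm

/-- **`Δ_W < 0` ⇒ a transposition prime divides `d_K`.** Under the hypotheses of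
`jacobiSym_minimalDiscriminantInt_natAbs_discr`, if `W.Δ < 0` then some prime `q ∣ d_K` has `(Δ_min(W) / q) = −1`;
such a `q` is odd, does not divide the conductor of `W` (split primes are unramified) and does not divide `Δ_min(W)`.
Equivalently: the number of primes `q ∣ d_K` at which the 2-division cubic of `W` has exactly one root mod `q` is odd.
[cite: SilvermanAEC2009, VIII.8] [cite: IrelandRosen1990, Prop. 5.2.2] -/
theorem exists_prime_dvd_discr_jacobiSym_eq_neg_one_of_Δ_neg (hK : IsImaginaryQuadratic K)
    (hodd : Odd (discr K)) (hH : SatisfiesHeegnerHypothesis (W.conductorNorm ℤ) K) (hΔ : W.Δ < 0) :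
    ∃ q : ℕ, q.Prime ∧ q ≠ 2 ∧ (q : ℤ) ∣ discr K ∧ ¬ q ∣ W.conductorNorm ℤ ∧
      ¬ (q : ℤ) ∣ minimalDiscriminantInt W ∧ jacobiSym (minimalDiscriminantInt W) q = -1 := by
  have hJ := jacobiSym_minimalDiscriminantInt_natAbs_discr W hK hodd hH
  rw [(sign_minimalDiscriminantInt_eq_neg_one_iff W).mpr hΔ] at hJ
  obtain ⟨q, hq, hqd, hJq⟩ := jacobiSym.eq_neg_one_at_prime_divisor_of_eq_neg_one hJ
  have hqd' : (q : ℤ) ∣ discr K := Int.ofNat_dvd_left.mpr hqd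
  have hq2 : q ≠ 2 := by
    rintro rfl
    exact (Int.not_even_iff_odd.mpr hodd) (even_iff_two_dvd.mpr (by exact_mod_cast hqd'))
  have hqN : ¬ q ∣ W.conductorNorm ℤ := fun hqN =>
    Literature.SatisfiesHeegnerHypothesis.not_dvd_discr hK.1 hH hq hqN hqd'
  refine ⟨q, hq, hq2, hqd', hqN, fun hqΔ => hqN (dvd_conductorNorm_of_dvd_minimalDiscriminantInt W hq hqΔ), hJq⟩

/-- **`Δ_W > 0` ⇒ `(Δ_min(W) | |d_K|) = 1`**: the number of transposition primes of `d_K` is even. [cite: IrelandRosen1990, Prop. 5.2.2] -/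
theorem jacobiSym_minimalDiscriminantInt_natAbs_discr_of_Δ_pos (hK : IsImaginaryQuadratic K)
    (hodd : Odd (discr K)) (hH : SatisfiesHeegnerHypothesis (W.conductorNorm ℤ) K) (hΔ : 0 < W.Δ) :
    jacobiSym (minimalDiscriminantInt W) (discr K).natAbs = 1 := by
  rw [jacobiSym_minimalDiscriminantInt_natAbs_discr W hK hodd hH, Int.sign_eq_one_iff_pos,
    ← @Int.cast_pos ℚ, cast_minimalDiscriminantInt]
  exact hΔ

/-! ## §3. Finite fields of odd characteristic: a cubic with non-square discriminant has a simple root -/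

section FiniteField

open Polynomial

variable {k : Type*} [Field k]

/-- **Descent for the `q`-Frobenius**: in any field extension `L ⊇ k` of a finite field `k` with `q` elements, an element
with `x ^ q = x` lies in `k` (the `q` elements of `k` are already `q` roots of `X ^ q − X`). [folklore] -/
theorem mem_range_algebraMap_of_pow_card_eq [Fintype k] {L : Type*} [Field L] [Algebra k L]
    {x : L} (hx : x ^ Fintype.card k = x) : x ∈ Set.range (algebraMap k L) := by
  classical
  have hq : 1 < Fintype.card k := Fintype.one_lt_card
  set f : L[X] := X ^ Fintype.card k - X with hf
  have hf0 : f ≠ 0 := FiniteField.X_pow_card_sub_X_ne_zero L hq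
  have hdeg : f.natDegree = Fintype.card k := FiniteField.X_pow_card_sub_X_natDegree_eq L hq
  set S : Finset L := Finset.univ.image (algebraMap k L) with hS
  have hScard : S.card = Fintype.card k := by
    rw [hS, Finset.card_image_of_injective _ (algebraMap k L).injective, Finset.card_univ]
  have hmem : ∀ y : L, y ∈ f.roots.toFinset ↔ y ^ Fintype.card k = y := fun y => by
    rw [Multiset.mem_toFinset, mem_roots hf0, IsRoot, hf, eval_sub, eval_pow, eval_X, sub_eq_zero]
  have hsub : S ⊆ f.roots.toFinset := by
    intro y hy
    obtain ⟨c, -, rfl⟩ := Finset.mem_image.mp hy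
    rw [hmem, ← map_pow, FiniteField.pow_card]
  have hcard : f.roots.toFinset.card ≤ S.card := by
    rw [hScard, ← hdeg]
    exact (Multiset.toFinset_card_le _).trans (card_roots' f)
  have heq : S = f.roots.toFinset := Finset.eq_of_subset_of_card_le hsub hcard
  have hx' : x ∈ f.roots.toFinset := (hmem x).mpr hx
  rw [← heq] at hx'
  obtain ⟨c, -, hc⟩ := Finset.mem_image.mp hx'
  exact ⟨c, hc⟩

/-- **A root of a cubic with non-zero discriminant is simple**: `P(t) = 0`, `discr P ≠ 0` ⇒ `P'(t) ≠ 0` (over an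
algebraic closure the three roots are distinct, so `P` is separable, i.e. coprime to `P'`). [folklore] -/
theorem eval_derivative_ne_zero_of_discr_ne_zero (P : Cubic k) (ha : P.a ≠ 0) (hdisc : P.discr ≠ 0)
    {t : k} (ht : P.toPoly.IsRoot t) : (derivative P.toPoly).eval t ≠ 0 := by
  let L := AlgebraicClosure k
  let φ := algebraMap k L
  obtain ⟨x, y, z, h3⟩ := (Cubic.splits_iff_roots_eq_three ha).mp (IsAlgClosed.splits (P.toPoly.map φ))
  have hnodup : (Cubic.map φ P).roots.Nodup := (Cubic.discr_ne_zero_iff_roots_nodup ha (IsAlgClosed.splits (P.toPoly.map φ))).mp hdisc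
  have hne : P.toPoly.map φ ≠ 0 := (Polynomial.map_ne_zero_iff φ.injective).mpr (Cubic.ne_zero_of_a_ne_zero ha)
  have hsep : (P.toPoly.map φ).Separable := by
    rw [Cubic.roots, Cubic.map_toPoly] at hnodup
    exact (nodup_roots_iff_of_splits hne (IsAlgClosed.splits _)).mp hnodup
  have hsepk : P.toPoly.Separable := (separable_map φ).mp hsep
  obtain ⟨u, v, huv⟩ := hsepk
  intro h0
  have h := congr_arg (eval t) huv
  rw [eval_add, eval_mul, eval_mul, ht.eq_zero, h0, mul_zero, mul_zero, add_zero, eval_one] at h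
  exact zero_ne_one h

/-- **A cubic over a finite field of odd characteristic whose discriminant is a non-square has a root.** If it had
none, the `q`-Frobenius would permute its three (distinct) roots in an algebraic closure without fixed point, i.e.
cyclically — an EVEN permutation, fixing `δ = a²(x−y)(x−z)(y−z)`; then `δ^{q−1} = 1`, so `disc = δ²` satisfies Euler's
criterion `disc^{(q−1)/2} = 1` and is a square. (Equivalently: `(disc / q) = −1` iff Frobenius is a transposition iff
exactly one root is rational — the «transposition primes» of the `2`-division cubic.) [folklore] -/
theorem exists_isRoot_of_not_isSquare_discr [Fintype k] (h2 : ringChar k ≠ 2) (P : Cubic k) (ha : P.a ≠ 0)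
    (hdisc : ¬ IsSquare P.discr) : ∃ t : k, P.toPoly.IsRoot t := by
  classical
  by_contra hno
  push Not at hno
  have hdisc0 : P.discr ≠ 0 := fun h => hdisc (h ▸ ⟨0, (mul_zero 0).symm⟩)
  let L := AlgebraicClosure k
  let φ := algebraMap k L
  obtain ⟨x, y, z, h3⟩ := (Cubic.splits_iff_roots_eq_three ha).mp (IsAlgClosed.splits (P.toPoly.map φ))
  have hδ := Cubic.discr_eq_prod_three_roots ha h3
  set δ := φ P.a * φ P.a * (x - y) * (x - z) * (y - z) with hδdef
  have hδ0 : δ ≠ 0 := by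
    intro h0
    apply hdisc0
    have : φ P.discr = 0 := by rw [hδ, h0, zero_pow two_ne_zero]
    exact (map_eq_zero φ).mp this
  have hxy : x ≠ y := by
    intro h; apply hδ0; rw [hδdef, h, sub_self]; ring
  have hxz : x ≠ z := by
    intro h; apply hδ0; rw [hδdef, h, sub_self]; ring
  have hyz : y ≠ z := by
    intro h; apply hδ0; rw [hδdef, h, sub_self]; ring
  -- the `q`-Frobenius of `L`
  obtain ⟨p, _instp⟩ := CharP.exists k
  obtain ⟨n, hp, hcard⟩ := FiniteField.card k p
  haveI : Fact p.Prime := ⟨hp⟩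
  haveI : CharP L p := (RingHom.charP_iff_charP φ p).mp inferInstance
  let F : L →+* L := iterateFrobenius L p n
  have hF : ∀ u : L, F u = u ^ Fintype.card k := fun u => by
    show iterateFrobenius L p n u = _
    rw [iterateFrobenius_def, hcard]
  have hFφ : ∀ c : k, F (φ c) = φ c := fun c => by rw [hF, ← map_pow, FiniteField.pow_card]
  have hcomp : F.comp φ = φ := RingHom.ext hFφ
  have hne : P.toPoly.map φ ≠ 0 := (Polynomial.map_ne_zero_iff φ.injective).mpr (Cubic.ne_zero_of_a_ne_zero ha)
  have hmem : ∀ u : L, u ∈ ({x, y, z} : Multiset L) ↔ (P.toPoly.map φ).eval u = 0 := fun u => by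
    rw [← h3, Cubic.roots, Cubic.map_toPoly, mem_roots hne, IsRoot]
  -- Frobenius maps roots to roots
  have hFroot : ∀ u : L, u ∈ ({x, y, z} : Multiset L) → F u ∈ ({x, y, z} : Multiset L) := by
    intro u hu
    rw [hmem] at hu ⊢
    have hh := Polynomial.hom_eval₂ P.toPoly φ F u
    rw [hcomp] at hh
    rw [eval_map] at hu ⊢
    rw [← hh, hu, map_zero]
  -- and has no fixed point among them (a fixed root would be `k`-rational)
  have hnofix : ∀ u : L, u ∈ ({x, y, z} : Multiset L) → F u ≠ u := by
    intro u hu hfix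
    obtain ⟨c, hc⟩ := mem_range_algebraMap_of_pow_card_eq (k := k) (L := L) (x := u)
      (by rw [← hF]; exact hfix)
    apply hno c
    have h0 : (P.toPoly.map φ).eval u = 0 := (hmem u).mp hu
    rw [← hc, eval_map, eval₂_at_apply, map_eq_zero] at h0
    exact h0
  have memx : x ∈ ({x, y, z} : Multiset L) := by simp
  have memy : y ∈ ({x, y, z} : Multiset L) := by simp
  have memz : z ∈ ({x, y, z} : Multiset L) := by simp
  have hFx : F x = y ∨ F x = z := by
    have h := hFroot x memx
    simp only [Multiset.insert_eq_cons, Multiset.mem_cons, Multiset.mem_singleton] at h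
    rcases h with h | h | h
    · exact absurd h (hnofix x memx)
    · exact Or.inl h
    · exact Or.inr h
  have hFy : F y = x ∨ F y = z := by
    have h := hFroot y memy
    simp only [Multiset.insert_eq_cons, Multiset.mem_cons, Multiset.mem_singleton] at h
    rcases h with h | h | h
    · exact Or.inl h
    · exact absurd h (hnofix y memy)
    · exact Or.inr h
  have hFz : F z = x ∨ F z = y := by
    have h := hFroot z memz
    simp only [Multiset.insert_eq_cons, Multiset.mem_cons, Multiset.mem_singleton] at h
    rcases h with h | h | h
    · exact Or.inl h
    · exact Or.inr h
    · exact absurd h (hnofix z memz)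
  have Finj := F.injective
  -- so it is a `3`-cycle, an even permutation: `F δ = δ`
  have key : F δ = δ := by
    rcases hFx with hx' | hx' <;> rcases hFy with hy' | hy' <;> rcases hFz with hz' | hz'
    · exact absurd (Finj (hy'.trans hz'.symm)) hyz
    · exact absurd (Finj (hx'.trans hz'.symm)) hxz
    · rw [hδdef]
      simp only [map_mul, map_sub, hx', hy', hz', hFφ]
      ring
    · exact absurd (Finj (hx'.trans hz'.symm)) hxz
    · exact absurd (Finj (hy'.trans hz'.symm)) hyz
    · rw [hδdef]
      simp only [map_mul, map_sub, hx', hy', hz', hFφ]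
      ring
    · exact absurd (Finj (hx'.trans hy'.symm)) hxy
    · exact absurd (Finj (hx'.trans hy'.symm)) hxy
  -- Euler's criterion
  have hq2 : Fintype.card k % 2 = 1 := by
    have := (FiniteField.even_card_iff_char_two (F := k)).not.mp h2
    omega
  have hq1 : 1 ≤ Fintype.card k := Fintype.card_pos
  have hpow : δ ^ Fintype.card k = δ := by rw [← hF]; exact key
  have hpow' : δ ^ (2 * (Fintype.card k / 2)) = 1 := by
    have h1 : δ ^ (Fintype.card k - 1) * δ = 1 * δ := by
      rw [← pow_succ, one_mul, Nat.sub_add_cancel hq1, hpow]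
    rw [show 2 * (Fintype.card k / 2) = Fintype.card k - 1 by omega]
    exact mul_right_cancel₀ hδ0 h1
  have hk1 : P.discr ^ (Fintype.card k / 2) = 1 := by
    apply φ.injective
    rw [map_pow, hδ, ← pow_mul, hpow', map_one]
  exact hdisc ((FiniteField.isSquare_iff h2 hdisc0).mpr hk1)

end FiniteField

end Summit.BirchSwinnertonDyer.BirchSwinnertonDyer.Theorems.GenusKolyTwin
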